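import Summits.AtomisticToContinuum.Crystallization.Theses.HcpThetaUniversality
import Literature.MathematicalPhysics.StatisticalMechanics.PeriodicConfigurationSums

/-!
# Route `HcpThetaUniversality`, item stmt-AtomisticToContinuum-5059 `ThetaMaxImpliesSutherlandBound`

Bernstein / Euler slicing of the inverse sixth power (the glue that makes the Gaussian packing
bound `HcpThetaMaxPackings` imply the van der Waals packing bound `SutherlandBound`).

For `d > 0`, Euler's integral `∫₀^∞ t^{a-1} e^{-ρ t} dt = Γ(a) ρ^{-a}` with `a = 3`, `ρ = d²`,
`Γ(3) = 2` reads `d⁻⁶ = ∫₀^∞ ½ t² e^{-t d²} dt`. Integrating the hypothesis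
`Σ_i Σ_{j ≠ i} e^{-t d_{ij}²} ≤ N · θ_hcp(t)` (`θ_hcp(t) = Σ_{y ∈ hcp ∖ 0} e^{-t ‖y‖²}`, every
`t > 0`) against the non-negative weight `½ t² dt` on `(0, ∞)` gives
`Σ_i Σ_{j ≠ i} d_{ij}⁻⁶ ≤ N · Σ_{y ∈ hcp ∖ 0} ‖y‖⁻⁶ = N · L₆(hcp)`, which is `SutherlandBound`
(the diagonal terms `dist(x_i, x_i)⁻¹ ^ 6` and the origin term `‖0‖⁻¹ ^ 6` are `0⁻¹ = 0`).

The whole computation is carried out in `ℝ≥0∞` (`lintegral`), where finite sums commute with the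
integral, the inequality integrates by monotonicity, and the exchange of the hcp sum with the
integral is Tonelli (`lintegral_tsum`; the hcp point set is countable). The return to `ℝ` uses the
summability of `Σ_{y ∈ hcp ∖ 0} ‖y‖⁻⁶` (`PeriodicConfiguration.summable_inv_pow_dist` applied to
`hcpPeriodicConfiguration`, exponent `6 > 3`); summability of the theta series itself is never
needed (`ofReal (∑' f) ≤ ∑' ofReal ∘ f` holds unconditionally for `f ≥ 0`).

Sources: the mechanism (a completely monotone potential of squared distance is a positive mixture
of Gaussians, so Gaussian energy bounds integrate to inverse-power bounds) is Cohn–Kumar,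
*Universally optimal distribution of points on spheres*, JAMS 20 (2007), §9, and
Coulangeon–Schürmann 2011, §4 ("equivalently, due to Bernstein's theorem, for any exponential
potential"); here only the single explicit slice `r⁻⁶ ↔ ½ t²` is used, a folklore Gamma-integral.
-/

noncomputable section

namespace Summit.AtomisticToContinuum.Crystallization.Theorems

open MeasureTheory Set
open scoped ENNReal
open Literature.MathematicalPhysics.StatisticalMechanics Literature.Barriers.AtomisticToContinuum

/-- Euler's integral for the inverse sixth power: for `0 < d`,
`∫₀^∞ ½ t² e^{-t d²} dt = d⁻⁶` (`= Γ(3) / (2 d⁶)`). [folklore] -/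
theorem integral_half_sq_mul_exp_neg_mul_sq {d : ℝ} (hd : 0 < d) :
    ∫ t in Ioi (0 : ℝ), 1 / 2 * t ^ 2 * Real.exp (-t * d ^ 2) = d⁻¹ ^ 6 := by
  have hρ : 0 < d ^ 2 := by positivity
  have h := Real.integral_rpow_mul_exp_neg_mul_Ioi (a := 3) (r := d ^ 2) (by norm_num) hρ
  have hG : Real.Gamma 3 = 2 := by norm_num [Nat.factorial]
  have h' : ∫ t in Ioi (0 : ℝ), t ^ 2 * Real.exp (-t * d ^ 2) = 2 * d⁻¹ ^ 6 := by
    rw [← setIntegral_congr_fun measurableSet_Ioi (fun t (_ : t ∈ Ioi (0 : ℝ)) =>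
      show t ^ ((3 : ℝ) - 1) * Real.exp (-(d ^ 2 * t)) = t ^ 2 * Real.exp (-t * d ^ 2) by
        rw [show (3 : ℝ) - 1 = 2 by norm_num, Real.rpow_two]; ring_nf), h, hG,
      show (3 : ℝ) = ((3 : ℕ) : ℝ) by norm_num, Real.rpow_natCast]
    field_simp
  calc ∫ t in Ioi (0 : ℝ), 1 / 2 * t ^ 2 * Real.exp (-t * d ^ 2)
      = ∫ t in Ioi (0 : ℝ), 1 / 2 * (t ^ 2 * Real.exp (-t * d ^ 2)) := by
        congr 1; funext t; ring
    _ = 1 / 2 * ∫ t in Ioi (0 : ℝ), t ^ 2 * Real.exp (-t * d ^ 2) := integral_const_mul _ _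
    _ = d⁻¹ ^ 6 := by rw [h']; ring

/-- `t ↦ ½ t² e^{-t d²}` is integrable on `(0, ∞)` for `0 < d`. [folklore] -/
theorem integrableOn_half_sq_mul_exp_neg_mul_sq {d : ℝ} (hd : 0 < d) :
    IntegrableOn (fun t : ℝ => 1 / 2 * t ^ 2 * Real.exp (-t * d ^ 2)) (Ioi 0) := by
  have h := integrableOn_rpow_mul_exp_neg_mul_rpow (s := 2) (p := 1) (b := d ^ 2)
    (by norm_num) le_rfl (by positivity)
  have h' : IntegrableOn (fun t : ℝ => t ^ 2 * Real.exp (-t * d ^ 2)) (Ioi 0) := by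
    refine h.congr_fun (fun t _ => ?_) measurableSet_Ioi
    simp only [Real.rpow_two, Real.rpow_one]
    ring_nf
  have h'' : IntegrableOn (fun t : ℝ => 1 / 2 * (t ^ 2 * Real.exp (-t * d ^ 2))) (Ioi 0) :=
    h'.const_mul (1 / 2)
  refine h''.congr_fun (fun t _ => ?_) measurableSet_Ioi
  simp only
  ring

/-- Euler's integral in `ℝ≥0∞`: `∫⁻₀^∞ ½ t² e^{-t d²} dt = d⁻⁶` for `0 < d`. [folklore] -/
theorem lintegral_half_sq_mul_exp_neg_mul_sq {d : ℝ} (hd : 0 < d) :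
    ∫⁻ t in Ioi (0 : ℝ), ENNReal.ofReal (1 / 2 * t ^ 2 * Real.exp (-t * d ^ 2)) =
      ENNReal.ofReal (d⁻¹ ^ 6) := by
  rw [← integral_half_sq_mul_exp_neg_mul_sq hd, ofReal_integral_eq_lintegral_ofReal
    (integrableOn_half_sq_mul_exp_neg_mul_sq hd)
    (Filter.Eventually.of_forall fun t => by simp only [Pi.zero_apply]; positivity)]

/-- `ofReal (∑' f) ≤ ∑' (ofReal ∘ f)` for every non-negative real family `f` (equality when `f`
is summable; otherwise the left side is the junk value `0`). [folklore] -/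
theorem ofReal_tsum_le_tsum_ofReal {ι : Type*} {f : ι → ℝ} (hf : ∀ i, 0 ≤ f i) :
    ENNReal.ofReal (∑' i, f i) ≤ ∑' i, ENNReal.ofReal (f i) := by
  by_cases h : Summable f
  · exact (ENNReal.ofReal_tsum_of_nonneg hf h).le
  · rw [tsum_eq_zero_of_not_summable h, ENNReal.ofReal_zero]
    exact bot_le

/-- The hcp point set is countable (an image of `ℤ³`). [folklore] -/
theorem countable_hcpStacking (a h : ℝ) : (hcpStacking a h).Countable := by
  refine (Set.countable_range
    (fun p : ℤ × ℤ × ℤ => barlowPos a h alternatingHagg p.1 p.2.1 p.2.2)).mono ?_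
  intro x hx
  obtain ⟨k, i, j, rfl⟩ := mem_barlowStacking_iff.mp hx
  exact ⟨(k, i, j), rfl⟩

/-- **`L₆(hcp) < ∞`**: `Σ_{y ∈ hcp ∖ 0} ‖y‖⁻⁶` is summable for the hexagonal close packing at
nearest-neighbour distance `1` (a periodic configuration of `ℝ³`, exponent `6 > 3`). [folklore] -/
theorem summable_inv_pow_six_hcpStacking :
    Summable fun y : {y : EuclideanSpace ℝ (Fin 3) //
      y ∈ hcpStacking 1 (Real.sqrt (2 / 3)) ∧ y ≠ 0} => ‖y.1‖⁻¹ ^ 6 := by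
  have hh : Real.sqrt (2 / 3) ≠ 0 := by positivity
  have h := (hcpPeriodicConfiguration (a := 1) (h := Real.sqrt (2 / 3)) one_ne_zero
    hh).summable_inv_pow_dist (n := 6) (by norm_num) 0
  rw [hcpPeriodicConfiguration_points] at h
  refine h.congr fun y => ?_
  rw [dist_zero_left]

/-- The index type `{y // y ∈ hcp ∧ y ≠ 0}` of the hcp lattice sums is countable. [folklore] -/
theorem countable_hcpStacking_ne_zero :
    Countable {y : EuclideanSpace ℝ (Fin 3) // y ∈ hcpStacking 1 (Real.sqrt (2 / 3)) ∧ y ≠ 0} := by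
  have h : ({y : EuclideanSpace ℝ (Fin 3) | y ∈ hcpStacking 1 (Real.sqrt (2 / 3)) ∧ y ≠ 0}).Countable :=
    (countable_hcpStacking 1 (Real.sqrt (2 / 3))).mono fun y hy => hy.1
  exact h.to_subtype

/-- **Tonelli on the hcp side**: `∫₀^∞ ½ t² θ_hcp(t) dt = L₆(hcp)` in `ℝ≥0∞`, i.e.
`∫⁻ Σ'_{y ∈ hcp ∖ 0} ofReal (½ t² e^{-t ‖y‖²}) dt = Σ'_{y ∈ hcp ∖ 0} ofReal (‖y‖⁻⁶)`. [folklore] -/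
theorem lintegral_tsum_half_sq_mul_exp_hcp :
    ∫⁻ t in Ioi (0 : ℝ),
        ∑' y : {y : EuclideanSpace ℝ (Fin 3) // y ∈ hcpStacking 1 (Real.sqrt (2 / 3)) ∧ y ≠ 0},
          ENNReal.ofReal (1 / 2 * t ^ 2 * Real.exp (-t * ‖y.1‖ ^ 2)) =
      ∑' y : {y : EuclideanSpace ℝ (Fin 3) // y ∈ hcpStacking 1 (Real.sqrt (2 / 3)) ∧ y ≠ 0},
        ENNReal.ofReal (‖y.1‖⁻¹ ^ 6) := by
  haveI := countable_hcpStacking_ne_zero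
  have hmeas : ∀ y : {y : EuclideanSpace ℝ (Fin 3) // y ∈ hcpStacking 1 (Real.sqrt (2 / 3)) ∧ y ≠ 0},
      AEMeasurable (fun t : ℝ => ENNReal.ofReal (1 / 2 * t ^ 2 * Real.exp (-t * ‖y.1‖ ^ 2)))
        (volume.restrict (Ioi (0 : ℝ))) := fun y => by fun_prop
  rw [lintegral_tsum hmeas]
  exact tsum_congr fun y => lintegral_half_sq_mul_exp_neg_mul_sq (norm_pos_iff.mpr y.2.2)

/-- **The finite side**: for a configuration with positive pairwise distances,
`ofReal (Σ_i Σ_{j ≠ i} d_{ij}⁻⁶) = ∫⁻₀^∞ Σ_i Σ_{j ≠ i} ofReal (½ t² e^{-t d_{ij}²}) dt`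
(Euler's integral termwise; finite sums commute with `∫⁻`). [folklore] -/
theorem ofReal_sum_inv_pow_six_eq_lintegral {N : ℕ} (x : Fin N → EuclideanSpace ℝ (Fin 3))
    (hx : ∀ i j, i ≠ j → 0 < dist (x i) (x j)) :
    ENNReal.ofReal (∑ i, ∑ j ∈ Finset.univ.erase i, (dist (x i) (x j))⁻¹ ^ 6) =
      ∫⁻ t in Ioi (0 : ℝ), ∑ i, ∑ j ∈ Finset.univ.erase i,
        ENNReal.ofReal (1 / 2 * t ^ 2 * Real.exp (-t * (dist (x i) (x j)) ^ 2)) := by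
  have hmeas : ∀ c : ℝ, Measurable fun t : ℝ =>
      ENNReal.ofReal (1 / 2 * t ^ 2 * Real.exp (-t * c ^ 2)) := fun c => by fun_prop
  calc ENNReal.ofReal (∑ i, ∑ j ∈ Finset.univ.erase i, (dist (x i) (x j))⁻¹ ^ 6)
      = ∑ i, ∑ j ∈ Finset.univ.erase i, ENNReal.ofReal ((dist (x i) (x j))⁻¹ ^ 6) := by
        rw [ENNReal.ofReal_sum_of_nonneg (fun i _ => Finset.sum_nonneg fun j _ => by positivity)]
        exact Finset.sum_congr rfl fun i _ =>
          ENNReal.ofReal_sum_of_nonneg fun j _ => by positivity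
    _ = ∑ i, ∑ j ∈ Finset.univ.erase i, ∫⁻ t in Ioi (0 : ℝ),
          ENNReal.ofReal (1 / 2 * t ^ 2 * Real.exp (-t * (dist (x i) (x j)) ^ 2)) := by
        refine Finset.sum_congr rfl fun i _ => Finset.sum_congr rfl fun j hj => ?_
        exact (lintegral_half_sq_mul_exp_neg_mul_sq (hx i j (Finset.ne_of_mem_erase hj).symm)).symm
    _ = ∑ i, ∫⁻ t in Ioi (0 : ℝ), ∑ j ∈ Finset.univ.erase i,
          ENNReal.ofReal (1 / 2 * t ^ 2 * Real.exp (-t * (dist (x i) (x j)) ^ 2)) := by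
        refine Finset.sum_congr rfl fun i _ => ?_
        exact (lintegral_finsetSum (Finset.univ.erase i) fun j _ => hmeas (dist (x i) (x j))).symm
    _ = ∫⁻ t in Ioi (0 : ℝ), ∑ i, ∑ j ∈ Finset.univ.erase i,
          ENNReal.ofReal (1 / 2 * t ^ 2 * Real.exp (-t * (dist (x i) (x j)) ^ 2)) := by
        exact (lintegral_finsetSum Finset.univ fun i _ =>
          Finset.measurable_fun_sum (Finset.univ.erase i) fun j _ => hmeas (dist (x i) (x j))).symm

/-- **The pointwise step**: at a fixed `t > 0`, the Gaussian packing bound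
`Σ_i Σ_{j ≠ i} e^{-t d_{ij}²} ≤ N θ_hcp(t)` multiplied by the weight `½ t²`, in `ℝ≥0∞`
(no summability of `θ_hcp` needed: `ofReal (∑' f) ≤ ∑' ofReal ∘ f`). [folklore] -/
theorem sum_ofReal_half_sq_mul_exp_le {N : ℕ} (x : Fin N → EuclideanSpace ℝ (Fin 3)) {t : ℝ}
    (ht : 0 < t)
    (hpack : ∑ i, ∑ j ∈ Finset.univ.erase i, Real.exp (-t * dist (x i) (x j) ^ 2) ≤
      (N : ℝ) * gaussianEnergy t (hcpStacking 1 (Real.sqrt (2 / 3)))) :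
    ∑ i, ∑ j ∈ Finset.univ.erase i,
        ENNReal.ofReal (1 / 2 * t ^ 2 * Real.exp (-t * (dist (x i) (x j)) ^ 2)) ≤
      (N : ℝ≥0∞) *
        ∑' y : {y : EuclideanSpace ℝ (Fin 3) // y ∈ hcpStacking 1 (Real.sqrt (2 / 3)) ∧ y ≠ 0},
          ENNReal.ofReal (1 / 2 * t ^ 2 * Real.exp (-t * ‖y.1‖ ^ 2)) := by
  have ht2 : 0 ≤ 1 / 2 * t ^ 2 := by positivity
  calc ∑ i, ∑ j ∈ Finset.univ.erase i,
        ENNReal.ofReal (1 / 2 * t ^ 2 * Real.exp (-t * (dist (x i) (x j)) ^ 2))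
      = ENNReal.ofReal (∑ i, ∑ j ∈ Finset.univ.erase i,
          1 / 2 * t ^ 2 * Real.exp (-t * (dist (x i) (x j)) ^ 2)) := by
        rw [ENNReal.ofReal_sum_of_nonneg
          (fun i _ => Finset.sum_nonneg fun j _ => by positivity)]
        exact Finset.sum_congr rfl fun i _ =>
          (ENNReal.ofReal_sum_of_nonneg fun j _ => by positivity).symm
    _ = ENNReal.ofReal (1 / 2 * t ^ 2 *
          ∑ i, ∑ j ∈ Finset.univ.erase i, Real.exp (-t * (dist (x i) (x j)) ^ 2)) := by
        congr 1
        rw [Finset.mul_sum]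
        exact Finset.sum_congr rfl fun i _ => by rw [Finset.mul_sum]
    _ ≤ ENNReal.ofReal (1 / 2 * t ^ 2 * ((N : ℝ) *
          gaussianEnergy t (hcpStacking 1 (Real.sqrt (2 / 3))))) := by
        gcongr
    _ = ENNReal.ofReal ((N : ℝ) *
          ∑' y : {y : EuclideanSpace ℝ (Fin 3) //
            y ∈ hcpStacking 1 (Real.sqrt (2 / 3)) ∧ y ≠ 0},
            1 / 2 * t ^ 2 * Real.exp (-t * ‖y.1‖ ^ 2)) := by
        congr 1
        rw [tsum_mul_left]
        unfold gaussianEnergy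
        ring
    _ = (N : ℝ≥0∞) * ENNReal.ofReal
          (∑' y : {y : EuclideanSpace ℝ (Fin 3) //
            y ∈ hcpStacking 1 (Real.sqrt (2 / 3)) ∧ y ≠ 0},
            1 / 2 * t ^ 2 * Real.exp (-t * ‖y.1‖ ^ 2)) := by
        rw [ENNReal.ofReal_mul (Nat.cast_nonneg N), ENNReal.ofReal_natCast]
    _ ≤ (N : ℝ≥0∞) *
          ∑' y : {y : EuclideanSpace ℝ (Fin 3) //
            y ∈ hcpStacking 1 (Real.sqrt (2 / 3)) ∧ y ≠ 0},
            ENNReal.ofReal (1 / 2 * t ^ 2 * Real.exp (-t * ‖y.1‖ ^ 2)) := by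
        gcongr
        exact ofReal_tsum_le_tsum_ofReal fun y => by positivity

/-- **Item stmt-AtomisticToContinuum-5059** (`ThetaMaxImpliesSutherlandBound`, route
`HcpThetaUniversality`, support/glue): the Gaussian packing bound for every `t > 0`
(`HcpThetaMaxPackings`) implies the inverse-sixth-power packing bound (`SutherlandBound`), by
integrating against `½ t² dt` (Bernstein slice `d⁻⁶ = ∫₀^∞ ½ t² e^{-t d²} dt`) and Tonelli on the
hcp side. [folklore] -/
theorem thetaMaxImpliesSutherlandBound_proof :
    Summit.AtomisticToContinuum.Crystallization.Theses.HcpThetaUniversality.ThetaMaxImpliesSutherlandBound := by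
  unfold Summit.AtomisticToContinuum.Crystallization.Theses.HcpThetaUniversality.ThetaMaxImpliesSutherlandBound
    Summit.AtomisticToContinuum.Crystallization.Theses.HcpThetaUniversality.HcpThetaMaxPackings
    Summit.AtomisticToContinuum.Crystallization.Theses.HcpThetaUniversality.SutherlandBound
  intro hΘ N x hx
  have hx' : ∀ i j, i ≠ j → 0 < dist (x i) (x j) :=
    fun i j hij => lt_of_lt_of_le one_pos (hx i j hij)
  -- (1) the diagonal terms vanish: `dist (x i) (x i)⁻¹ ^ 6 = 0⁻¹ ^ 6 = 0`
  have hdiag : ∑ i, ∑ j, (dist (x i) (x j))⁻¹ ^ 6 =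
      ∑ i, ∑ j ∈ Finset.univ.erase i, (dist (x i) (x j))⁻¹ ^ 6 := by
    refine Finset.sum_congr rfl fun i _ => ?_
    rw [Finset.sum_erase]
    simp
  -- (2) the origin term vanishes: `L₆` over hcp equals `L₆` over `hcp ∖ 0`
  have hidx : (∑' y : ↥(hcpStacking 1 (Real.sqrt (2 / 3))), ‖(y : EuclideanSpace ℝ (Fin 3))‖⁻¹ ^ 6) =
      ∑' y : {y : EuclideanSpace ℝ (Fin 3) // y ∈ hcpStacking 1 (Real.sqrt (2 / 3)) ∧ y ≠ 0},
        ‖y.1‖⁻¹ ^ 6 :=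
    tsum_setElem_eq_tsum_setElem_sdiff (f := fun y : EuclideanSpace ℝ (Fin 3) => ‖y‖⁻¹ ^ 6)
      (hcpStacking 1 (Real.sqrt (2 / 3))) {0} fun b hb => by
        rw [Set.mem_singleton_iff] at hb
        simp [hb]
  -- (3) the Bernstein / Tonelli chain in `ℝ≥0∞`
  have hkey : ENNReal.ofReal (∑ i, ∑ j ∈ Finset.univ.erase i, (dist (x i) (x j))⁻¹ ^ 6) ≤
      ENNReal.ofReal ((N : ℝ) *
        ∑' y : {y : EuclideanSpace ℝ (Fin 3) // y ∈ hcpStacking 1 (Real.sqrt (2 / 3)) ∧ y ≠ 0},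
          ‖y.1‖⁻¹ ^ 6) := by
    calc ENNReal.ofReal (∑ i, ∑ j ∈ Finset.univ.erase i, (dist (x i) (x j))⁻¹ ^ 6)
        = ∫⁻ t in Ioi (0 : ℝ), ∑ i, ∑ j ∈ Finset.univ.erase i,
            ENNReal.ofReal (1 / 2 * t ^ 2 * Real.exp (-t * (dist (x i) (x j)) ^ 2)) :=
          ofReal_sum_inv_pow_six_eq_lintegral x hx'
      _ ≤ ∫⁻ t in Ioi (0 : ℝ), (N : ℝ≥0∞) *
            ∑' y : {y : EuclideanSpace ℝ (Fin 3) // y ∈ hcpStacking 1 (Real.sqrt (2 / 3)) ∧ y ≠ 0},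
              ENNReal.ofReal (1 / 2 * t ^ 2 * Real.exp (-t * ‖y.1‖ ^ 2)) :=
          setLIntegral_mono' measurableSet_Ioi fun t ht =>
            sum_ofReal_half_sq_mul_exp_le x ht (hΘ t ht N x hx)
      _ = (N : ℝ≥0∞) * ∫⁻ t in Ioi (0 : ℝ),
            ∑' y : {y : EuclideanSpace ℝ (Fin 3) // y ∈ hcpStacking 1 (Real.sqrt (2 / 3)) ∧ y ≠ 0},
              ENNReal.ofReal (1 / 2 * t ^ 2 * Real.exp (-t * ‖y.1‖ ^ 2)) :=
          lintegral_const_mul' _ _ (ENNReal.natCast_ne_top N)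
      _ = (N : ℝ≥0∞) *
            ∑' y : {y : EuclideanSpace ℝ (Fin 3) // y ∈ hcpStacking 1 (Real.sqrt (2 / 3)) ∧ y ≠ 0},
              ENNReal.ofReal (‖y.1‖⁻¹ ^ 6) := by
          rw [lintegral_tsum_half_sq_mul_exp_hcp]
      _ = ENNReal.ofReal ((N : ℝ) *
            ∑' y : {y : EuclideanSpace ℝ (Fin 3) // y ∈ hcpStacking 1 (Real.sqrt (2 / 3)) ∧ y ≠ 0},
              ‖y.1‖⁻¹ ^ 6) := by
          rw [ENNReal.ofReal_mul (Nat.cast_nonneg N), ENNReal.ofReal_natCast,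
            ENNReal.ofReal_tsum_of_nonneg (fun _ => by positivity) summable_inv_pow_six_hcpStacking]
  -- (4) back to `ℝ`
  have hL : (0 : ℝ) ≤
      ∑' y : {y : EuclideanSpace ℝ (Fin 3) // y ∈ hcpStacking 1 (Real.sqrt (2 / 3)) ∧ y ≠ 0},
        ‖y.1‖⁻¹ ^ 6 :=
    tsum_nonneg fun _ => by positivity
  rw [hdiag, hidx]
  exact (ENNReal.ofReal_le_ofReal_iff (mul_nonneg (Nat.cast_nonneg N) hL)).1 hkey

end Summit.AtomisticToContinuum.Crystallization.Theorems

end
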